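import Summits.CriticalPhenomena.PercolationContinuityZ3.Theorems.PercNearOneGluingNoHeavyConstsClusterSquareApexLinked
import HarnessLib

/-!
# Outerplanar graph plus one apex: the endgames when the APEX is a terminal or the root

builds on p205010 (kernel theorem, internal audit signed; external expert review pending)

PAPER-2 track "percolation constants", part (ii), seat `prim-consts-1`, gen 21 (lane index
`run/shared/lean/prim/consts/CONSTANTS.md`, row A19; memo `FROM-prim-consts-1-g21-APEX-TERMINAL.md`).
Support file for the crux `NoHeavyLowerTail` (stmt-CriticalPhenomena-4575; `--supports`).  Theorems only; no definitions, no sorries.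

Setting of `…ConstsClusterSquareApexGap.lean` / `…ApexLinked.lean` / `…Apex.lean`: `H` on `Fin n`, apex `h`, rim positions `pos`
(injective on the rim), (R) rim edges pairwise non-crossing, (F) no rim edge separates two apex-neighbours; auxiliary graphs `G₀`
(rim edges) and `H'` (rim edges + chords between apex-neighbours) with no `H'`-edge crossing a `G₀`-edge.  `…ClusterSquareApex.lean`
treats terminals `a, b, c` ON THE RIM.  Here the apex itself is a terminal or the root.  The extra hypothesis is the SECTOR CONDITION
(S) for the two rim terminals `a, b`: no two apex-neighbours `u, v` are separated by `{a, b}` on the rim circle (`u` strictly inside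
one of the two arcs between `a` and `b`, `v` strictly inside the other) — `a` and `b` lie in a common closed sector of the apex; it
holds whenever `a, b, h` lie on a common face, and it is necessary for the combinatorial statements below (rim 4-cycle, apex joined
to two opposite corners, `a, b` the other two corners: doubly linked at `K = {a}` and at `K = {h}`).
* `Consts.Apex.sector_rot`: (S) is invariant under cutting the circle open at any base point.
* `Consts.Apex.false_of_linked_apexEnd` (terminals `b` and the APEX, root `a ∈ K` on the rim, `h ∉ K`, clash vertices `y, y'` on the
  rim): the walks `y' → h`, `y → h` end with apex-neighbours `x₂, x₁`; the sets `K ∪ {y}`, `K ∪ {y'}` put `b` strictly between `y`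
  and `y'` (cut open at `a`); `K ∪ supp(y → b)` tested with `h → y'` and `K ∪ supp(y' → b)` tested with `h → y` then put `b` strictly
  between `x₁` and `x₂`, i.e. the apex-neighbours `x₁, x₂` are separated by `{a, b}` — contradicting (S).
* `Consts.Apex.false_of_linked_apexOnly` (root = apex, `K = {h}`, clash vertices `y, y' ∈ N(h)`, rim terminals `s, t`): by (S)
  `y, y'` lie in the same arc cut out by `{s, t}`, so one of the two linkages is interleaved on the circle and its
  second walk is tested against the support of its first (cut open at `y`).
  (For root = apex and `K ≠ {h}` the rim endgame `Consts.Apex.false_of_linked_rim` applies verbatim with a rim vertex of `K` as base.)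
* `Consts.Apex.exists_rim_graphs`: the instantiation of `G₀, H'` from (R)+(F) (as inside `Consts.Apex.unlinked`), recorded once.
`…ConstsClusterSquareApexHub.lean` assembles these into the unlinkedness statements and the CSQ/DUU/TS corollaries.
Census (lane engine g21 `eng/apex_terminal.py`, exhaustive over all (R)+(F) graphs with ≤ 6 rim vertices = 73 472 graphs): root on
the rim with the apex as a terminal under (S): 0 doubly linked clusters in 9 545 160 cases (41 298 without (S)); root = apex: 0 in
4 488 192 cases under (S) (11 685 without (S), all at `K = {h}`; clusters `K ∋ h` with a rim vertex: 0 even without (S)).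
References: N. Gladkov, arXiv:2408.08457v2 (2024) (two-copy vdBK behind `…ClusterSquareUnlinked`); G. Chartrand, F. Harary,
Ann. Inst. H. Poincaré B 3 (1967) 433–438 (outerplanar graphs).
-/

noncomputable section

open Classical

namespace Summit.CriticalPhenomena.PercolationContinuityZ3.Theorems

open MeasureTheory Finset Literature.Probability.LatticeModels Literature.Probability.Percolation

namespace Consts

namespace Apex

variable {n m : ℕ} {pos : Fin n → Fin m} {h : Fin n}

/-- Order fact 1 of the apex-terminal endgame: if neither `Y` nor `Y'` lies strictly between the other and `B`, then `B` lies
strictly between `Y` and `Y'`. [folklore] -/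
private theorem arith_end₁ {Y Y' B : ℕ} (dYY' : Y ≠ Y') (dYB : Y ≠ B) (dY'B : Y' ≠ B)
    (f1 : ¬ (Y' < Y ∧ Y < B) ∧ ¬ (B < Y ∧ Y < Y')) (f2 : ¬ (Y < Y' ∧ Y' < B) ∧ ¬ (B < Y' ∧ Y' < Y)) :
    (Y < B ∧ B < Y') ∨ (Y' < B ∧ B < Y) := by
  omega

/-- Order fact 2 of the apex-terminal endgame: with `P < B < Q`, `B` not strictly between `Z` and `Q` and not strictly between
`X` and `P`, one gets `X < B < Z`. [folklore] -/
private theorem arith_end₂ {P Q B X Z : ℕ} (lP : P < B) (lQ : B < Q) (dXB : X ≠ B) (dZB : Z ≠ B)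
    (fZ : ¬ (Z < B ∧ B < Q) ∧ ¬ (Q < B ∧ B < Z)) (fX : ¬ (X < B ∧ B < P) ∧ ¬ (P < B ∧ B < X)) :
    X < B ∧ B < Z := by
  omega

/-- Order fact of the apex-root endgame: of three distinct points `S, T, Y'`, if `Y'` is not strictly between `S` and `T` then `S`
is strictly between `Y'` and `T` or `T` is strictly between `Y'` and `S`. [folklore] -/
private theorem arith_only {S T Y' : ℕ} (dY'S : Y' ≠ S) (dY'T : Y' ≠ T) (dST : S ≠ T)
    (ny : ¬ ((S < Y' ∧ Y' < T) ∨ (T < Y' ∧ Y' < S))) :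
    ((Y' < S ∧ S < T) ∨ (T < S ∧ S < Y')) ∨ ((Y' < T ∧ T < S) ∨ (S < T ∧ T < Y')) := by
  omega

/-! ### The sector condition in the cut-open order -/

/-- The sector condition (S) for `{s, t}` — no two apex-neighbours `u, v` with `u` strictly between `s` and `t` and `v` strictly
outside — is rotation invariant: it holds verbatim in the order cut open at any base point `o`. [folklore] -/
theorem sector_rot {H : SimpleGraph (Fin n)} {s t : Fin n}
    (hS : ∀ u v, H.Adj h u → H.Adj h v → ((pos s < pos u ∧ pos u < pos t) ∨ (pos t < pos u ∧ pos u < pos s)) →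
      ((pos v < pos s ∧ pos v < pos t) ∨ (pos s < pos v ∧ pos t < pos v)) → False)
    (o : Fin n) {u v : Fin n} (hu : H.Adj h u) (hv : H.Adj h v)
    (h1 : ((pos s - pos o).val < (pos u - pos o).val ∧ (pos u - pos o).val < (pos t - pos o).val) ∨
      ((pos t - pos o).val < (pos u - pos o).val ∧ (pos u - pos o).val < (pos s - pos o).val))
    (h2 : ((pos v - pos o).val < (pos s - pos o).val ∧ (pos v - pos o).val < (pos t - pos o).val) ∨
      ((pos s - pos o).val < (pos v - pos o).val ∧ (pos t - pos o).val < (pos v - pos o).val)) : False := by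
  have ls := (pos s).isLt; have lt' := (pos t).isLt; have lu := (pos u).isLt; have lv := (pos v).isLt
  simp only [NonCrossing.val_sub_eq] at h1 h2
  have key : ((((pos s : ℕ) < pos u ∧ (pos u : ℕ) < pos t) ∨ ((pos t : ℕ) < pos u ∧ (pos u : ℕ) < pos s)) ∧
        (((pos v : ℕ) < pos s ∧ (pos v : ℕ) < pos t) ∨ ((pos s : ℕ) < pos v ∧ (pos t : ℕ) < pos v))) ∨
      ((((pos s : ℕ) < pos v ∧ (pos v : ℕ) < pos t) ∨ ((pos t : ℕ) < pos v ∧ (pos v : ℕ) < pos s)) ∧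
        (((pos u : ℕ) < pos s ∧ (pos u : ℕ) < pos t) ∨ ((pos s : ℕ) < pos u ∧ (pos t : ℕ) < pos u))) := by
    split_ifs at h1 h2 <;> omega
  rcases key with ⟨k1, k2⟩ | ⟨k1, k2⟩
  · exact hS u v hu hv k1 k2
  · exact hS v u hv hu k1 k2

/-! ### The endgames -/

section Endgame

variable {H G₀ H' : SimpleGraph (Fin n)} {a : Fin n}
  (hpos : ∀ u v, u ≠ h → v ≠ h → pos u = pos v → u = v)
  (g1 : ∀ u v, H.Adj u v → u ≠ h → v ≠ h → G₀.Adj u v)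
  (g2 : ∀ u v, H.Adj u v → u ≠ h → v ≠ h → H'.Adj u v)
  (g3 : ∀ u v, u ≠ v → u ≠ h → v ≠ h → H.Adj h u → H.Adj h v → H'.Adj u v)
  (x1 : ∀ p q r s : Fin n, H'.Adj p q → G₀.Adj r s → (pos p - pos a).val < (pos r - pos a).val →
    (pos r - pos a).val < (pos q - pos a).val → (pos q - pos a).val < (pos s - pos a).val → False)
  (x2 : ∀ p q r s : Fin n, G₀.Adj p q → H'.Adj r s → (pos p - pos a).val < (pos r - pos a).val →
    (pos r - pos a).val < (pos q - pos a).val → (pos q - pos a).val < (pos s - pos a).val → False)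
  (ha : a ≠ h)
include hpos g1 g2 g3 x1 x2 ha

/-- APEX-TERMINAL ENDGAME: an `H`-connected `K ∋ a` avoiding the apex, with RIM clash vertices `y ≠ y'` (each joined to `K`), cannot
carry both linkages `(y → b, y' → h)` and `(y → h, y' → b)` by walks avoiding `K`, disjoint within each pair, when the terminals are
a rim vertex `b` and the APEX `h` and no two apex-neighbours are separated by `{a, b}` (sector condition, cut open at `a`: no
apex-neighbours `u ≠ a`, `v` with `u` before `b` and `v` after `b`).  [folklore: Jordan curve] -/
theorem false_of_linked_apexEnd {K : Set (Fin n)} (hKw : ∀ s ∈ K, ∃ W : H.Walk a s, ∀ v ∈ W.support, v ∈ K)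
    {b y y' k k' : Fin n} (hb : b ≠ h) (hyh : y ≠ h) (hy'h : y' ≠ h)
    (hkK : k ∈ K) (hky : H.Adj k y) (hk'K : k' ∈ K) (hk'y' : H.Adj k' y')
    (hyb : y ≠ b) (hy'b : y' ≠ b) (hyy' : y ≠ y')
    (hS : ∀ u v, u ≠ a → H.Adj h u → H.Adj h v → (pos u - pos a).val < (pos b - pos a).val →
      (pos b - pos a).val < (pos v - pos a).val → False)
    (P₁ : H.Walk y b) (P₂ : H.Walk y' h) (hP₁ : ∀ x ∈ P₁.support, x ∉ K) (hP₂ : ∀ x ∈ P₂.support, x ∉ K)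
    (hPd : ∀ x, x ∈ P₁.support → x ∉ P₂.support)
    (Q₁ : H.Walk y h) (Q₂ : H.Walk y' b) (hQ₁ : ∀ x ∈ Q₁.support, x ∉ K) (hQ₂ : ∀ x ∈ Q₂.support, x ∉ K)
    (hQd : ∀ x, x ∈ Q₁.support → x ∉ Q₂.support) : False := by
  have haK : a ∈ K := by
    obtain ⟨W, hW⟩ := hKw k hkK
    exact hW a W.start_mem_support
  -- memberships in the four supports
  have hyP₁ : y ∈ P₁.support := P₁.start_mem_support
  have hbP₁ : b ∈ P₁.support := P₁.end_mem_support
  have hy'P₂ : y' ∈ P₂.support := P₂.start_mem_support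
  have hyQ₁ : y ∈ Q₁.support := Q₁.start_mem_support
  have hy'Q₂ : y' ∈ Q₂.support := Q₂.start_mem_support
  have hbQ₂ : b ∈ Q₂.support := Q₂.end_mem_support
  -- distinct positions (cut open at `a`)
  have D : ∀ {u v : Fin n}, u ≠ h → v ≠ h → u ≠ v → (pos u - pos a).val ≠ (pos v - pos a).val :=
    fun hu hv huv e => huv (hpos _ _ hu hv (NonCrossing.rot_injective (pos a) e))
  -- the walks to the apex, reversed, start with apex-neighbours `x₂` (of `P₂`) and `x₁` (of `Q₁`)
  suffices main : ∀ (R₂ : H.Walk h y') (R₁ : H.Walk h y), (∀ x ∈ R₂.support, x ∈ P₂.support) →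
      (∀ x ∈ R₁.support, x ∈ Q₁.support) → False by
    exact main P₂.reverse Q₁.reverse
      (fun x hx => by rwa [SimpleGraph.Walk.support_reverse, List.mem_reverse] at hx)
      (fun x hx => by rwa [SimpleGraph.Walk.support_reverse, List.mem_reverse] at hx)
  intro R₂ R₁ hR₂ hR₁
  cases R₂ with
  | nil => exact hy'h rfl
  | @cons _ x₂ _ hx₂ W₂ =>
  cases R₁ with
  | nil => exact hyh rfl
  | @cons _ x₁ _ hx₁ W₁ =>
  have hx₂R : x₂ ∈ (SimpleGraph.Walk.cons hx₂ W₂).support := by simp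
  have hy'R : y' ∈ (SimpleGraph.Walk.cons hx₂ W₂).support := SimpleGraph.Walk.end_mem_support _
  have hx₁R : x₁ ∈ (SimpleGraph.Walk.cons hx₁ W₁).support := by simp
  have hyR : y ∈ (SimpleGraph.Walk.cons hx₁ W₁).support := SimpleGraph.Walk.end_mem_support _
  have hx₂P₂ : x₂ ∈ P₂.support := hR₂ x₂ hx₂R
  have hx₁Q₁ : x₁ ∈ Q₁.support := hR₁ x₁ hx₁R
  have hx₁h : x₁ ≠ h := fun e => hx₁.ne e.symm
  have hx₂h : x₂ ≠ h := fun e => hx₂.ne e.symm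
  have hx₁a : x₁ ≠ a := fun e => hQ₁ x₁ hx₁Q₁ (by rw [e]; exact haK)
  have hx₂a : x₂ ≠ a := fun e => hP₂ x₂ hx₂P₂ (by rw [e]; exact haK)
  have hx₁b : x₁ ≠ b := fun e => hQd x₁ hx₁Q₁ (by rw [e]; exact hbQ₂)
  have hx₂b : x₂ ≠ b := fun e => hPd b hbP₁ (by rw [← e]; exact hx₂P₂)
  have dYY' := D hyh hy'h hyy'
  have dYB := D hyh hb hyb
  have dY'B := D hy'h hb hy'b
  have d1B := D hx₁h hb hx₁b
  have d2B := D hx₂h hb hx₂b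
  -- (1) `K ∪ {y}` tested with `Q₂ : y' → b`, and `K ∪ {y'}` tested with `P₁ : y → b`: `b` is strictly between `y` and `y'`
  have hSy := NonCrossing.walks_extend hKw hkK hky (SimpleGraph.Walk.nil : H.Walk y y)
  have hSy' := NonCrossing.walks_extend hKw hk'K hk'y' (SimpleGraph.Walk.nil : H.Walk y' y')
  have memy : ∀ v, v ∈ K ∪ {v | v ∈ (SimpleGraph.Walk.nil : H.Walk y y).support} ↔ v ∈ K ∨ v = y := fun v => by
    simp only [Set.mem_union, Set.mem_setOf_eq, SimpleGraph.Walk.support_nil, List.mem_singleton]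
  have memy' : ∀ v, v ∈ K ∪ {v | v ∈ (SimpleGraph.Walk.nil : H.Walk y' y').support} ↔ v ∈ K ∨ v = y' := fun v => by
    simp only [Set.mem_union, Set.mem_setOf_eq, SimpleGraph.Walk.support_nil, List.mem_singleton]
  have F1 := cnt_eq_ends hpos g1 g2 g3 x1 x2 ha hSy
    (S' := {s | s ∈ K ∪ {v | v ∈ (SimpleGraph.Walk.nil : H.Walk y y).support} ∧ s ≠ h}) (fun _ => Iff.rfl) Q₂
    (fun v hv hvS => by
      rcases (memy v).1 hvS with hvK | rfl
      · exact hQ₂ v hv hvK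
      · exact hQd _ hyQ₁ hv) hy'h hb
  have F2 := cnt_eq_ends hpos g1 g2 g3 x1 x2 ha hSy'
    (S' := {s | s ∈ K ∪ {v | v ∈ (SimpleGraph.Walk.nil : H.Walk y' y').support} ∧ s ≠ h}) (fun _ => Iff.rfl) P₁
    (fun v hv hvS => by
      rcases (memy' v).1 hvS with hvK | rfl
      · exact hP₁ v hv hvK
      · exact hPd _ hv hy'P₂) hyh hb
  have hyS : y ∈ ({s | s ∈ K ∪ {v | v ∈ (SimpleGraph.Walk.nil : H.Walk y y).support} ∧ s ≠ h} : Set (Fin n)) :=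
    ⟨(memy y).2 (Or.inr rfl), hyh⟩
  have hy'S : y' ∈ ({s | s ∈ K ∪ {v | v ∈ (SimpleGraph.Walk.nil : H.Walk y' y').support} ∧ s ≠ h} : Set (Fin n)) :=
    ⟨(memy' y').2 (Or.inr rfl), hy'h⟩
  have f1 := NonCrossing.not_between_of_cnt_eq_pos' a _ F1 hyS
  have f2 := NonCrossing.not_between_of_cnt_eq_pos' a _ F2 hy'S
  have hB := arith_end₁ dYY' dYB dY'B f1 f2
  -- (2) `K ∪ supp P₁ ∋ b` tested with the walk `h → y'` inside `P₂`: `b` is not strictly between `x₂` and `y'`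
  have hS₃ := NonCrossing.walks_extend hKw hkK hky P₁
  have F3 := cnt_eq_of_walk hpos g1 g2 g3 x1 x2 ha hS₃ (S' := {s | s ∈ K ∪ {v | v ∈ P₁.support} ∧ s ≠ h})
    (fun _ => Iff.rfl) (SimpleGraph.Walk.cons hx₂ W₂) (fun v hv hvS => by
      rcases hvS with hvK | hvP
      · exact hP₂ v (hR₂ v hv) hvK
      · exact hPd v hvP (hR₂ v hv)) x₂ hx₂R y' hy'R hx₂h hy'h
  have f3 := NonCrossing.not_between_of_cnt_eq_pos' a _ F3 ⟨Or.inr hbP₁, hb⟩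
  -- (3) `K ∪ supp Q₂ ∋ b` tested with the walk `h → y` inside `Q₁`: `b` is not strictly between `x₁` and `y`
  have hS₄ := NonCrossing.walks_extend hKw hk'K hk'y' Q₂
  have F4 := cnt_eq_of_walk hpos g1 g2 g3 x1 x2 ha hS₄ (S' := {s | s ∈ K ∪ {v | v ∈ Q₂.support} ∧ s ≠ h})
    (fun _ => Iff.rfl) (SimpleGraph.Walk.cons hx₁ W₁) (fun v hv hvS => by
      rcases hvS with hvK | hvQ
      · exact hQ₁ v (hR₁ v hv) hvK
      · exact hQd v (hR₁ v hv) hvQ) x₁ hx₁R y hyR hx₁h hyh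
  have f4 := NonCrossing.not_between_of_cnt_eq_pos' a _ F4 ⟨Or.inr hbQ₂, hb⟩
  -- (4) so `b` separates the apex-neighbours `x₁` and `x₂` — contradicting the sector condition
  rcases hB with ⟨l1, l2⟩ | ⟨l1, l2⟩
  · obtain ⟨e1, e2⟩ := arith_end₂ l1 l2 d1B d2B f3 f4
    exact hS x₁ x₂ hx₁a hx₁ hx₂ e1 e2
  · obtain ⟨e1, e2⟩ := arith_end₂ l1 l2 d2B d1B f4 f3
    exact hS x₂ x₁ hx₂a hx₂ hx₁ e1 e2

end Endgame

/-- APEX-ROOT ENDGAME, cluster `K = {h}`: two distinct apex-neighbours `y, y'` on the rim cannot carry both linkages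
`(y → s, y' → t)` and `(y → t, y' → s)` by walks with disjoint supports within each pair, when the rim terminals `s ≠ t` satisfy
the sector condition (S) (no two apex-neighbours separated by `{s, t}`): `y, y'` then lie in a common arc cut out by `{s, t}`, so one
linkage is interleaved on the rim circle and its second walk crosses the support of its first (gap lemma cut open at `y`).
[folklore: Jordan curve] -/
theorem false_of_linked_apexOnly {H G₀ H' : SimpleGraph (Fin n)}
    (hpos : ∀ u v, u ≠ h → v ≠ h → pos u = pos v → u = v)
    (g1 : ∀ u v, H.Adj u v → u ≠ h → v ≠ h → G₀.Adj u v)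
    (g2 : ∀ u v, H.Adj u v → u ≠ h → v ≠ h → H'.Adj u v)
    (g3 : ∀ u v, u ≠ v → u ≠ h → v ≠ h → H.Adj h u → H.Adj h v → H'.Adj u v)
    (h12 : ∀ p q r s : Fin n, H'.Adj p q → G₀.Adj r s → pos p < pos r → pos r < pos q → pos q < pos s → False)
    (h21 : ∀ p q r s : Fin n, G₀.Adj p q → H'.Adj r s → pos p < pos r → pos r < pos q → pos q < pos s → False)
    {s t y y' : Fin n} (hs : s ≠ h) (ht : t ≠ h) (hyh : y ≠ h) (hy'h : y' ≠ h) (hy : H.Adj h y) (hy' : H.Adj h y')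
    (hys : y ≠ s) (hyt : y ≠ t) (hy's : y' ≠ s) (hy't : y' ≠ t) (hst : s ≠ t)
    (hS : ∀ u v, H.Adj h u → H.Adj h v → ((pos s < pos u ∧ pos u < pos t) ∨ (pos t < pos u ∧ pos u < pos s)) →
      ((pos v < pos s ∧ pos v < pos t) ∨ (pos s < pos v ∧ pos t < pos v)) → False)
    (P₁ : H.Walk y s) (P₂ : H.Walk y' t) (hPd : ∀ x, x ∈ P₁.support → x ∉ P₂.support)
    (Q₁ : H.Walk y t) (Q₂ : H.Walk y' s) (hQd : ∀ x, x ∈ Q₁.support → x ∉ Q₂.support) : False := by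
  -- cut open at `y`
  have x1 : ∀ p q r s' : Fin n, H'.Adj p q → G₀.Adj r s' → (pos p - pos y).val < (pos r - pos y).val →
      (pos r - pos y).val < (pos q - pos y).val → (pos q - pos y).val < (pos s' - pos y).val → False :=
    fun p q r s' hpq hrs => noncross_rot₂ h12 h21 y hpq hrs
  have x2 : ∀ p q r s' : Fin n, G₀.Adj p q → H'.Adj r s' → (pos p - pos y).val < (pos r - pos y).val →
      (pos r - pos y).val < (pos q - pos y).val → (pos q - pos y).val < (pos s' - pos y).val → False :=
    fun p q r s' hpq hrs => noncross_rot₂ h21 h12 y hpq hrs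
  have D : ∀ {u v : Fin n}, u ≠ h → v ≠ h → u ≠ v → (pos u - pos y).val ≠ (pos v - pos y).val :=
    fun hu hv huv e => huv (hpos _ _ hu hv (NonCrossing.rot_injective (pos y) e))
  have dY'S := D hy'h hs hy's
  have dY'T := D hy'h ht hy't
  have dST := D hs ht hst
  have h0S : (pos y - pos y).val < (pos s - pos y).val := by
    rw [NonCrossing.rot_self]
    exact Nat.pos_of_ne_zero fun e => D hs hyh hys.symm (by rw [e, NonCrossing.rot_self])
  have h0T : (pos y - pos y).val < (pos t - pos y).val := by
    rw [NonCrossing.rot_self]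
    exact Nat.pos_of_ne_zero fun e => D ht hyh hyt.symm (by rw [e, NonCrossing.rot_self])
  -- (S): `y'` is not strictly between `s` and `t` in the order cut open at `y`
  have ny : ¬ (((pos s - pos y).val < (pos y' - pos y).val ∧ (pos y' - pos y).val < (pos t - pos y).val) ∨
      ((pos t - pos y).val < (pos y' - pos y).val ∧ (pos y' - pos y).val < (pos s - pos y).val)) :=
    fun hb => sector_rot hS y hy' hy hb (Or.inl ⟨h0S, h0T⟩)
  -- supports of walks from `y` are connected from `y`
  have conn : ∀ {t' : Fin n} (W : H.Walk y t'), ∀ v ∈ {v | v ∈ W.support}, ∃ W' : H.Walk y v,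
      ∀ z ∈ W'.support, z ∈ {v | v ∈ W.support} :=
    fun W v hv => ⟨W.takeUntil v hv, fun z hz => W.support_takeUntil_subset_support hv hz⟩
  rcases arith_only dY'S dY'T dST ny with hP | hQ
  · -- the linkage `(y → s, y' → t)` is interleaved: `P₂` avoids `supp P₁ ∋ s`
    have F := cnt_eq_ends hpos g1 g2 g3 x1 x2 hyh (conn P₁) (S' := {v | v ∈ {v | v ∈ P₁.support} ∧ v ≠ h})
      (fun _ => Iff.rfl) P₂ (fun v hv hvS => hPd v hvS hv) hy'h ht
    have f := NonCrossing.not_between_of_cnt_eq_pos' y _ F ⟨P₁.end_mem_support, hs⟩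
    exact absurd hP (by omega)
  · -- the linkage `(y → t, y' → s)` is interleaved: `Q₂` avoids `supp Q₁ ∋ t`
    have F := cnt_eq_ends hpos g1 g2 g3 x1 x2 hyh (conn Q₁) (S' := {v | v ∈ {v | v ∈ Q₁.support} ∧ v ≠ h})
      (fun _ => Iff.rfl) Q₂ (fun v hv hvS => hQd v hvS hv) hy'h hs
    have f := NonCrossing.not_between_of_cnt_eq_pos' y _ F ⟨Q₁.end_mem_support, ht⟩
    exact absurd hQ (by omega)

/-! ### The auxiliary graphs, instantiated -/

/-- The two auxiliary graphs of `…ConstsClusterSquareApexGap.lean` exist for every `H` satisfying (R) and (F): a rim graph `G₀` (the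
rim edges of `H`) and a hub-contracted graph `H'` (rim edges plus a chord between every two rim apex-neighbours) with no `H'`-edge
crossing a `G₀`-edge, in both orders (the construction inside `Consts.Apex.unlinked`, recorded for reuse). [folklore] -/
theorem exists_rim_graphs (H : SimpleGraph (Fin n)) (h : Fin n) (pos : Fin n → Fin m)
    (hR : ∀ p q r s : Fin n, p ≠ h → q ≠ h → r ≠ h → s ≠ h → H.Adj p q → H.Adj r s →
      pos p < pos r → pos r < pos q → pos q < pos s → False)
    (hF : ∀ p q u v : Fin n, p ≠ h → q ≠ h → H.Adj p q → H.Adj h u → H.Adj h v →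
      pos p < pos u → pos u < pos q → (pos q < pos v ∨ pos v < pos p) → False) :
    ∃ G₀ H' : SimpleGraph (Fin n),
      (∀ u v, H.Adj u v → u ≠ h → v ≠ h → G₀.Adj u v) ∧
      (∀ u v, H.Adj u v → u ≠ h → v ≠ h → H'.Adj u v) ∧
      (∀ u v, u ≠ v → u ≠ h → v ≠ h → H.Adj h u → H.Adj h v → H'.Adj u v) ∧
      (∀ p q r s : Fin n, H'.Adj p q → G₀.Adj r s → pos p < pos r → pos r < pos q → pos q < pos s → False) ∧
      (∀ p q r s : Fin n, G₀.Adj p q → H'.Adj r s → pos p < pos r → pos r < pos q → pos q < pos s → False) := by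
  let G₀ : SimpleGraph (Fin n) := SimpleGraph.fromRel fun u v => H.Adj u v ∧ u ≠ h ∧ v ≠ h
  let H' : SimpleGraph (Fin n) := SimpleGraph.fromRel fun u v => u ≠ h ∧ v ≠ h ∧ (H.Adj u v ∨ (H.Adj h u ∧ H.Adj h v))
  have hG₀ : ∀ u v, G₀.Adj u v → H.Adj u v ∧ u ≠ h ∧ v ≠ h := by
    intro u v huv
    rcases (SimpleGraph.fromRel_adj _ u v).1 huv with ⟨_, ⟨e, hu, hv⟩ | ⟨e, hv, hu⟩⟩
    · exact ⟨e, hu, hv⟩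
    · exact ⟨e.symm, hu, hv⟩
  have hH' : ∀ u v, H'.Adj u v → u ≠ h ∧ v ≠ h ∧ (H.Adj u v ∨ (H.Adj h u ∧ H.Adj h v)) := by
    intro u v huv
    rcases (SimpleGraph.fromRel_adj _ u v).1 huv with ⟨_, ⟨hu, hv, e⟩ | ⟨hv, hu, e⟩⟩
    · exact ⟨hu, hv, e⟩
    · rcases e with e | ⟨e1, e2⟩
      · exact ⟨hu, hv, Or.inl e.symm⟩
      · exact ⟨hu, hv, Or.inr ⟨e2, e1⟩⟩
  refine ⟨G₀, H', fun u v e hu hv => (SimpleGraph.fromRel_adj _ u v).2 ⟨e.ne, Or.inl ⟨e, hu, hv⟩⟩,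
    fun u v e hu hv => (SimpleGraph.fromRel_adj _ u v).2 ⟨e.ne, Or.inl ⟨hu, hv, Or.inl e⟩⟩,
    fun u v huv hu hv e1 e2 => (SimpleGraph.fromRel_adj _ u v).2 ⟨huv, Or.inl ⟨hu, hv, Or.inr ⟨e1, e2⟩⟩⟩, ?_, ?_⟩
  · intro p q r s hpq hrs l1 l2 l3
    obtain ⟨hp, hq, e⟩ := hH' p q hpq
    obtain ⟨ers, hr, hs⟩ := hG₀ r s hrs
    rcases e with e | ⟨e1, e2⟩
    · exact hR p q r s hp hq hr hs e ers l1 l2 l3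
    · exact hF r s q p hr hs ers e2 e1 l2 l3 (Or.inr l1)
  · intro p q r s hpq hrs l1 l2 l3
    obtain ⟨epq, hp, hq⟩ := hG₀ p q hpq
    obtain ⟨hr, hs, e⟩ := hH' r s hrs
    rcases e with e | ⟨e1, e2⟩
    · exact hR p q r s hp hq hr hs epq e l1 l2 l3
    · exact hF p q r s hp hq epq e1 e2 l1 l2 (Or.inl l3)

end Apex

end Consts

end Summit.CriticalPhenomena.PercolationContinuityZ3.Theorems
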